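import Literature.Computability.MetaComplexity.DLOResLinTreeLike
import HarnessLib

/-!
# `DLO_n` in tree-like Res(⊕): Theorem 5 of Gryaznov–Ovcharov–Riazanov 2024 and its non-vacuity

* **Theorem 5** (`two_pow_le_length_dloCNF_treeLike`, `le_resLinClauseSpace_dloCNF`,
  `le_minResLinClauseSpace_dloCNF`) [GOR 2024, Thm 5; Gryaznov 2019, Thm 3.7]: every TREE-LIKE Res(⊕)
  refutation (semantic weakening; every line used as a premise at most once) of `DLO_n` has at least
  `2^{⌊(n−3)/3⌋+1}` lines, and every configuration-style Res(⊕) refutation keeps at least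
  `⌊(n−3)/3⌋ + 1` linear clauses in memory at some moment (print: `2^{⌊(n−3)/3⌋}`, `⌊(n−3)/3⌋`; the
  printed proof gives one more, `DLOResLinTreeLike.lean`). From Lemma 4 (`isExtensible_dloCNF`) and
  GOR Theorems 1–2 (`ResLinExtensible.lean`).
* Non-vacuity: `DLO_n` is unsatisfiable for `n ≥ 2` (`dloCNF_not_satisfiable`: in a satisfying
  assignment the order is linear and the two bottom elements `s ≺ t` have no witness between them)
  and has a tree-like Res(⊕) refutation with `3·2^{n²+n³} − 1` lines
  (`exists_treeLike_isResLinRefutation_dloCNF`, decision tree of `ResLinTreeLikeCompleteness.lean`).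

## References

* S. Gryaznov, S. Ovcharov, A. Riazanov, ACM Trans. Comput. Theory 16(3) (2024) = arXiv:2404.08370,
  §3.1.3, Theorem 5 [GryaznovOvcharovRiazanov2024].
* S. Gryaznov, CSR 2019, LNCS 11532, §3.3, Theorem 3.7 [Gryaznov2019].
-/

namespace Literature.Computability.MetaComplexity

open _root_.Computability Complexity Finset OrderParity

/-! ### Theorem 5 -/

/-- **Theorem 5, tree-like size** [Gryaznov–Ovcharov–Riazanov 2024, Thm 5 (`2^{⌊(n−3)/3⌋}` in
print); Gryaznov 2019, Thm 3.7]: every TREE-LIKE Res(⊕) refutation of `DLO_n` has at least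
`2^{⌊(n−3)/3⌋+1}` lines. [cite: GryaznovOvcharovRiazanov2024, Theorem 5] -/
theorem two_pow_le_length_dloCNF_treeLike {n : ℕ} {π : List ResLinLine}
    (hπ : IsResLinRefutation (dloCNF n) π)
    (htree : ∀ i : ℕ, (π.map fun l => l.premises.count i).sum ≤ 1) :
    2 ^ ((n - 3) / 3 + 1) ≤ π.length :=
  two_pow_le_length_of_isExtensible (isExtensible_dloCNF n) (exists_isFProper_worderClauses n)
    hπ htree

/-- **Theorem 5, clause space** [Gryaznov–Ovcharov–Riazanov 2024, Thm 5 (`⌊(n−3)/3⌋` in print)]: every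
configuration-style Res(⊕) refutation of `DLO_n` keeps at least `⌊(n−3)/3⌋ + 1` linear clauses in
memory at some moment. [cite: GryaznovOvcharovRiazanov2024, Theorem 5] -/
theorem le_resLinClauseSpace_dloCNF {n : ℕ} {π : List (Finset LinClause)}
    (hπ : IsResLinSpaceRefutation (dloCNF n) π) : (n - 3) / 3 + 1 ≤ resLinClauseSpace π :=
  le_resLinClauseSpace_of_isExtensible (isExtensible_dloCNF n) (exists_isFProper_worderClauses n) hπ

/-- Theorem 5, clause space, `ℕ∞` form. [Gryaznov–Ovcharov–Riazanov 2024, Thm 5]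
[cite: GryaznovOvcharovRiazanov2024, Theorem 5] -/
theorem le_minResLinClauseSpace_dloCNF (n : ℕ) :
    (((n - 3) / 3 + 1 : ℕ) : ℕ∞) ≤ minResLinClauseSpace (dloCNF n) :=
  le_minResLinClauseSpace_of_isExtensible (isExtensible_dloCNF n) (exists_isFProper_worderClauses n)

/-! ### Non-vacuity -/

/-- **`DLO_n` is unsatisfiable** (`n ≥ 2`): a satisfying assignment is `WORDER_n`-proper, hence a
linear order with legal witnesses; its two bottom elements `s ≺ t` falsify `D_{st}` (a witness `k`
would satisfy `s ≺ k ≺ t`). [Gryaznov–Ovcharov–Riazanov 2024, §3.1.3 ("a finite linearly ordered set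
cannot be dense")] [cite: GryaznovOvcharovRiazanov2024, §3.1.3] -/
theorem dloCNF_not_satisfiable {n : ℕ} (hn : 2 ≤ n) : ¬ (dloCNF n).Satisfiable := by
  classical
  rintro ⟨σ, hσ⟩
  rw [CNF.eval_eq_true_iff] at hσ
  have hprop : IsFProper (worderClauses n) σ := fun c hc => hσ c (mem_dloCNF_of_mem_worderClauses hc)
  obtain ⟨hord, hwit⟩ := isFProper_worderClauses_iff.1 hprop
  have hinj := injOn_rankOf hord
  -- the minimum `s` and the second minimum `t`
  obtain ⟨s, hs, hsmin⟩ := Finset.exists_min_image (Finset.range n) (rankOf n σ)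
    ⟨0, Finset.mem_range.2 (by omega)⟩
  have hne : ((Finset.range n).erase s).Nonempty := by
    rw [← Finset.card_pos, Finset.card_erase_of_mem hs, Finset.card_range]; omega
  obtain ⟨t, ht, htmin⟩ := Finset.exists_min_image ((Finset.range n).erase s) (rankOf n σ) hne
  obtain ⟨hts, ht'⟩ := Finset.mem_erase.1 ht
  rw [Finset.mem_range] at hs ht'
  have hst : rankOf n σ s < rankOf n σ t :=
    lt_of_le_of_ne (hsmin t (Finset.mem_range.2 ht')) fun h =>
      hts (hinj (by simpa using ht') (by simpa using hs) h.symm)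
  have hσst : σ (ordVar n s t) = true := (eq_true_iff_rankOf_lt hord hs ht' (Ne.symm hts)).2 hst
  rcases eval_densityClause_iff.1 (hσ _ (densityClause_mem_dloCNF hs ht' (Ne.symm hts))) with h | h
  · rw [hσst] at h; exact Bool.noConfusion h
  · obtain ⟨k, hk, hks, hkt, hz⟩ := h
    obtain ⟨h1, h2⟩ := hwit (s, k, t) (mem_distinctTriples.2 ⟨hs, hk, ht', Ne.symm hks, Ne.symm hts, hkt⟩) hz
    have hsk := (eq_true_iff_rankOf_lt hord hs hk (Ne.symm hks)).1 h1
    have hkt' := (eq_true_iff_rankOf_lt hord hk ht' hkt).1 h2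
    have := htmin k (Finset.mem_erase.2 ⟨hks, Finset.mem_range.2 hk⟩)
    omega

/-- Every variable of `DLO_n` is below `n² + n³`. [folklore] -/
theorem fst_lt_of_mem_dloCNF {n : ℕ} {c : Clause ℕ} (hc : c ∈ dloCNF n) {l : Literal ℕ}
    (hl : l ∈ c) : l.1 < n * n + n * n * n := by
  have hx : ∀ {k l : ℕ}, k < n → l < n → ordVar n k l < n * n + n * n * n :=
    fun hk hl => Nat.lt_of_lt_of_le (ordVar_lt hk hl) (Nat.le_add_right _ _)
  rcases mem_dloCNF_iff.1 hc with hc | ⟨s, t, hs, ht, -, rfl⟩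
  · rcases mem_worderClauses_iff.1 hc with hc | ⟨τ, hτ, rfl | rfl⟩
    · exact Nat.lt_of_lt_of_le (fst_lt_of_mem_orderingCNF (mem_orderingCNF_of_mem_linOrderClauses hc) hl)
        (Nat.le_add_right _ _)
    · obtain ⟨h1, h2, h3, -⟩ := mem_distinctTriples.1 hτ
      simp only [List.mem_cons, List.not_mem_nil, or_false] at hl
      rcases hl with rfl | rfl
      · exact (zVar_bounds h1 h2 h3).2
      · exact hx h1 h2
    · obtain ⟨h1, h2, h3, -⟩ := mem_distinctTriples.1 hτ
      simp only [List.mem_cons, List.not_mem_nil, or_false] at hl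
      rcases hl with rfl | rfl
      · exact (zVar_bounds h1 h2 h3).2
      · exact hx h2 h3
  · unfold densityClause at hl
    simp only [List.mem_cons, List.mem_map, List.mem_filter, List.mem_range,
      decide_eq_true_eq] at hl
    rcases hl with rfl | ⟨k, ⟨hk, -⟩, rfl⟩
    · exact hx hs ht
    · exact (zVar_bounds (τ := (s, k, t)) hs hk ht).2

/-- **Theorem 5 is not vacuous**: for `n ≥ 2` the CNF `DLO_n` HAS tree-like Res(⊕) refutations — the
decision tree on the indices below `n² + n³`, with exactly `3·2^{n²+n³} − 1` lines.
[Itsykson–Sokolov 2020, §2 (completeness); Gryaznov–Ovcharov–Riazanov 2024, §3.1.3]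
[cite: ItsyksonSokolov2020, §2] -/
theorem exists_treeLike_isResLinRefutation_dloCNF {n : ℕ} (hn : 2 ≤ n) :
    ∃ π : List ResLinLine, IsResLinRefutation (dloCNF n) π ∧
      (∀ i : ℕ, (π.map fun l => l.premises.count i).sum ≤ 1) ∧
      π.length + 1 = 3 * 2 ^ (n * n + n * n * n) := by
  have hvars : ∀ c ∈ dloCNF n, ∀ l ∈ c, l.1 ∈ List.range (n * n + n * n * n) :=
    fun c hc l hl => List.mem_range.2 (fst_lt_of_mem_dloCNF hc hl)
  obtain ⟨π, hπ, htree, hlen⟩ := exists_treeLike_isResLinRefutation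
    (dloCNF_not_satisfiable hn) List.nodup_range hvars
  exact ⟨π, hπ, htree, by simpa using hlen⟩

/-- The two bounds side by side: for `n ≥ 2` there is a tree-like Res(⊕) refutation of `DLO_n`, and
every one has at least `2^{⌊(n−3)/3⌋+1}` lines. [Gryaznov–Ovcharov–Riazanov 2024, Thm 5; folklore
upper bound] [cite: GryaznovOvcharovRiazanov2024, Theorem 5] -/
theorem treeLike_dloCNF_bounds {n : ℕ} (hn : 2 ≤ n) :
    (∃ π : List ResLinLine, IsResLinRefutation (dloCNF n) π ∧
      (∀ i : ℕ, (π.map fun l => l.premises.count i).sum ≤ 1) ∧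
      π.length < 3 * 2 ^ (n * n + n * n * n)) ∧
    (∀ π : List ResLinLine, IsResLinRefutation (dloCNF n) π →
      (∀ i : ℕ, (π.map fun l => l.premises.count i).sum ≤ 1) →
      2 ^ ((n - 3) / 3 + 1) ≤ π.length) := by
  obtain ⟨π, hπ, htree, hlen⟩ := exists_treeLike_isResLinRefutation_dloCNF hn
  exact ⟨⟨π, hπ, htree, by omega⟩, fun π hπ htree => two_pow_le_length_dloCNF_treeLike hπ htree⟩

end Literature.Computability.MetaComplexity
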